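import Summits.BirchSwinnertonDyer.BirchSwinnertonDyer.Theorems.Rank2Observatory2DescRealSieve
import Summits.BirchSwinnertonDyer.BirchSwinnertonDyer.Theorems.Rank2Observatory2DescPIDCert
import HarnessLib

/-!
# BirchSwinnertonDyer — rank ≥ 2 observatory: integral-basis ("ω") elements for general 2-descent over a NON-monogenic cubic field

HONEST FRAMING: per-curve certified theorems and census instruments; no claim on BSD in rank ≥ 2.

Generic addendum of the KERNEL-2DESC instrument (design `b2b-bsdr2-cert-3/KERNEL-2DESC.md` §10,
version 1.2: the `2`-division fields `K = ℚ(α)` whose reduced defining cubic `g` has index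
`[𝓞 K : ℤ[α]] > 1`). Version 1 wrote every certificate element as `lin hα c₀ c₁ c₂ = c₀ + c₁α + c₂α²
∈ ℤ[α]`; when `ℤ[α] ≠ 𝓞 K` the root `θ` of `F`, the prime generators and the units may lie outside
`ℤ[α]`, and two residue maps `ψ : 𝓞 K → ℤ/p` at a prime `p` dividing the index may agree on `α`.
Nothing in the soundness theorems (`mordellWeilRank_le_of_coverSet`, `admStd_sound`,
`admStd3R_sound`, `isPrincipalIdealRing_of_cert_lt`, `prime_of_natAbs_norm_eq_prime_pow`) uses
monogenicity: they speak about arbitrary elements of `𝓞 K`. This file supplies the element layer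
for an integral basis `(1, ω₁, ω₂)` given by two algebraic integers with `d·ωᵢ ∈ ℤ[α]`:
* `linB ω₁ ω₂ n₀ n₁ n₂ = n₀ + n₁ω₁ + n₂ω₂` and its image in `K` (`coe_linB`);
* `dmul_eq_lin_of_coe`, `dmul_linB` — `d · linB = lin hα m₀ m₁ m₂` with integer `m`, from
  `(ωᵢ : K) = (aᵢ₀ + aᵢ₁α + aᵢ₂α²)/d`;
* `norm_of_dmul`, `linB_norm`, `linB_prime`, `linB_prime_pow` — norm and primality from the norm
  form of `d·x` (`d³·N(x) = normForm(m)`), degree `2, 3` primes with a residual non-vanishing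
  certificate;
* `pos_of_dmul` / `neg_of_dmul` / `lt_of_dmul` (`linB_pos`, `linB_neg`, `linB_lt_linB`) — signs and
  the ordering of real places from the isolating intervals, through `d·x ∈ ℤ[α]`;
* `psi_linB`, `psi_eq_of_dmul`, `psi_linB_of_root` — the value of a residue map on `linB`, either
  from the pair `(ψ ω₁, ψ ω₂)` or, at `p ∤ d`, from the root `t = ψ(α)`;
* `psi_rel`, `cert_of_pairs`, `psi_linB_ne_zero_of_pairs`, `psi_linB_ne_zero_of_roots` — the
  residue maps at a prime dividing `d` are enumerated by the PAIRS `(u₁, u₂) ∈ (ℤ/p)²` satisfying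
  the multiplication table of `(ω₁, ω₂)` (a `decide`-able finite check), which separates the
  degree-one primes that share the residue of `α`;
* `linB_ne`, `unitOfCoe`, `aeval_algebraMap_eq_zero_of_coe`, `root_rel_of_aeval` — injectivity of
  coordinates, units from an inverse checked in `K`, and `F(θ) = 0` checked in `K`.
All identities between such elements are checked in the field `K` (rational coordinates on
`1, α, α²`, one `linear_combination` against `g(α) = 0`), never in `𝓞 K`.

Sorry-free; axioms `propext`, `Classical.choice`, `Quot.sound`. [folklore]
[cite: Marcus2018, Ch. 2, Thm. 9; Ch. 3, Thm. 22 and Thm. 27] (orders of finite index, prime ideals and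
norms, splitting of primes) [cite: Cassels1991LecturesEllipticCurves, §15]
-/

-- single-conjunct summit: `Summit.BirchSwinnertonDyer.BirchSwinnertonDyer.…` repeats the name by design
set_option linter.dupNamespace false

noncomputable section

open scoped Classical NumberField

open Literature.NumberTheory.NumberFields Polynomial Module NumberField

namespace Summit.BirchSwinnertonDyer.BirchSwinnertonDyer.Rank2Observatory.TwoDescCubic

variable {K : Type*} [Field K] {a b c : ℤ} {θ : K}

/-! ## The elements `n₀ + n₁ω₁ + n₂ω₂` -/

/-- The algebraic integer `n₀ + n₁ω₁ + n₂ω₂` on two given algebraic integers `ω₁, ω₂` (an integral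
basis `(1, ω₁, ω₂)` in the applications). [folklore] -/
def linB (ω₁ ω₂ : 𝓞 K) (n₀ n₁ n₂ : ℤ) : 𝓞 K :=
  (n₀ : 𝓞 K) + (n₁ : 𝓞 K) * ω₁ + (n₂ : 𝓞 K) * ω₂

/-- `linB` in `K`. [folklore] -/
theorem coe_linB (ω₁ ω₂ : 𝓞 K) (n₀ n₁ n₂ : ℤ) :
    ((linB ω₁ ω₂ n₀ n₁ n₂ : 𝓞 K) : K) = (n₀ : K) + (n₁ : K) * (ω₁ : K) + (n₂ : K) * (ω₂ : K) := by
  simp only [linB, map_add, map_mul, map_intCast]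

/-- The cubic relation of `θ` down in `K`. [folklore] -/
theorem root_rel_of_aeval (hθ : aeval θ (MonicCubic.poly a b c) = 0) :
    θ ^ 3 + (a : K) * θ ^ 2 + (b : K) * θ + (c : K) = 0 := by
  rwa [aeval_poly_eq] at hθ

/-- `F(x) = 0` for an algebraic integer `x`, checked in `K`. [folklore] -/
theorem aeval_algebraMap_eq_zero_of_coe {x : 𝓞 K} {A B C : ℤ}
    (h : (x : K) ^ 3 + (A : K) * (x : K) ^ 2 + (B : K) * (x : K) + (C : K) = 0) :
    aeval (algebraMap (𝓞 K) K x) (MonicCubic.poly A B C) = 0 := by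
  rw [aeval_poly_eq]
  exact h

/-- **`d·ω ∈ ℤ[α]`** from the rational coordinates of `ω`: `(ω : K) = (a₀ + a₁α + a₂α²)/d` gives
`d·ω = lin hα a₀ a₁ a₂` in `𝓞 K`. [cite: Marcus2018, Ch. 2, Thm. 9] -/
theorem dmul_eq_lin_of_coe (hθ : aeval θ (MonicCubic.poly a b c) = 0) {ω : 𝓞 K} {d : ℕ}
    (hd : (d : K) ≠ 0) {a₀ a₁ a₂ : ℤ}
    (h : ((ω : 𝓞 K) : K) = ((a₀ : K) + (a₁ : K) * θ + (a₂ : K) * θ ^ 2) / (d : K)) :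
    (d : 𝓞 K) * ω = lin hθ a₀ a₁ a₂ := by
  apply RingOfIntegers.ext
  change algebraMap (𝓞 K) K ((d : 𝓞 K) * ω) = algebraMap (𝓞 K) K (lin hθ a₀ a₁ a₂)
  rw [map_mul, map_natCast, algebraMap_lin, ← RingOfIntegers.coe_eq_algebraMap, h,
    mul_div_cancel₀ _ hd]

/-- `d · (n₀ + n₁ω₁ + n₂ω₂) = (dn₀ + n₁a₀ + n₂b₀) + (n₁a₁ + n₂b₁)α + (n₁a₂ + n₂b₂)α²`. [folklore] -/
theorem dmul_linB (hθ : aeval θ (MonicCubic.poly a b c) = 0) {ω₁ ω₂ : 𝓞 K} {d : ℕ}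
    {a₀ a₁ a₂ b₀ b₁ b₂ : ℤ}
    (h₁ : (d : 𝓞 K) * ω₁ = lin hθ a₀ a₁ a₂) (h₂ : (d : 𝓞 K) * ω₂ = lin hθ b₀ b₁ b₂)
    (n₀ n₁ n₂ : ℤ) :
    (d : 𝓞 K) * linB ω₁ ω₂ n₀ n₁ n₂ =
      lin hθ (d * n₀ + n₁ * a₀ + n₂ * b₀) (n₁ * a₁ + n₂ * b₁) (n₁ * a₂ + n₂ * b₂) := by
  have e : (d : 𝓞 K) * linB ω₁ ω₂ n₀ n₁ n₂ =
      (n₀ : 𝓞 K) * d + n₁ * ((d : 𝓞 K) * ω₁) + n₂ * ((d : 𝓞 K) * ω₂) := by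
    simp only [linB]
    ring
  rw [e, h₁, h₂]
  simp only [lin]
  push_cast
  ring

/-- **Distinct coordinates give distinct elements**, through `d·x ∈ ℤ[α]`. [folklore] -/
theorem linB_ne [NumberField K] (hirr : Irreducible (MonicCubic.polyQ a b c))
    (hθ : aeval θ (MonicCubic.poly a b c) = 0) (h3 : finrank ℚ K = 3) {ω₁ ω₂ : 𝓞 K} {d : ℕ}
    {a₀ a₁ a₂ b₀ b₁ b₂ : ℤ}
    (h₁ : (d : 𝓞 K) * ω₁ = lin hθ a₀ a₁ a₂) (h₂ : (d : 𝓞 K) * ω₂ = lin hθ b₀ b₁ b₂)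
    {n₀ n₁ n₂ n₀' n₁' n₂' : ℤ}
    (hne : d * n₀ + n₁ * a₀ + n₂ * b₀ ≠ d * n₀' + n₁' * a₀ + n₂' * b₀ ∨
      n₁ * a₁ + n₂ * b₁ ≠ n₁' * a₁ + n₂' * b₁ ∨ n₁ * a₂ + n₂ * b₂ ≠ n₁' * a₂ + n₂' * b₂) :
    linB ω₁ ω₂ n₀ n₁ n₂ ≠ linB ω₁ ω₂ n₀' n₁' n₂' := by
  intro h
  have h' := congrArg (fun x : 𝓞 K => (d : 𝓞 K) * x) h
  simp only [dmul_linB hθ h₁ h₂] at h'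
  exact lin_ne hirr hθ h3 hne h'

/-- **A unit from an explicit inverse**, the product checked in `K`. [folklore] -/
def unitOfCoe (x y : 𝓞 K) (h : (x : K) * (y : K) = 1) : (𝓞 K)ˣ :=
  ⟨x, y, RingOfIntegers.ext (by simp only [map_mul, map_one]; exact h),
    RingOfIntegers.ext (by simp only [map_mul, map_one]; rw [mul_comm]; exact h)⟩

/-- The underlying element of `unitOfCoe`. [folklore] -/
@[simp] theorem coe_unitOfCoe (x y : 𝓞 K) (h : (x : K) * (y : K) = 1) :
    ((unitOfCoe x y h : (𝓞 K)ˣ) : 𝓞 K) = x := rfl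

/-- `IsUnit` from an inverse checked in `K`. [folklore] -/
theorem isUnit_of_coe (x y : 𝓞 K) (h : (x : K) * (y : K) = 1) : IsUnit x :=
  (unitOfCoe x y h).isUnit

/-! ## Norms and primality through `d·x ∈ ℤ[α]` -/

/-- **Norm**: `N(x) = N` from `d·x = lin hα m` and `normForm(m) = d³·N`. [folklore] -/
theorem norm_of_dmul [NumberField K] (hirr : Irreducible (MonicCubic.polyQ a b c))
    (hθ : aeval θ (MonicCubic.poly a b c) = 0) (h3 : finrank ℚ K = 3) {x : 𝓞 K} {d : ℕ}
    (hd : d ≠ 0) {m₀ m₁ m₂ : ℤ} (hdx : (d : 𝓞 K) * x = lin hθ m₀ m₁ m₂) {N : ℤ}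
    (hN : MonicCubic.normForm a b c m₀ m₁ m₂ = (((d : ℤ) ^ 3 * N : ℤ) : ℚ)) :
    Algebra.norm ℚ ((x : 𝓞 K) : K) = (N : ℚ) := by
  have h1 := norm_lin_eq hirr hθ h3 m₀ m₁ m₂ hN
  rw [← hdx] at h1
  simp only [map_mul, map_natCast] at h1
  rw [show (d : K) = algebraMap ℚ K (d : ℚ) by simp, Algebra.norm_algebraMap, h3] at h1
  push_cast at h1
  have hd' : (d : ℚ) ^ 3 ≠ 0 := pow_ne_zero 3 (Nat.cast_ne_zero.mpr hd)
  exact mul_left_cancel₀ hd' h1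

/-- **Prime of degree one**: `|N(x)| = p` prime. [cite: Marcus2018, Ch. 3, Thm. 22] -/
theorem prime_of_dmul [NumberField K] (hirr : Irreducible (MonicCubic.polyQ a b c))
    (hθ : aeval θ (MonicCubic.poly a b c) = 0) (h3 : finrank ℚ K = 3) {x : 𝓞 K} {d : ℕ}
    (hd : d ≠ 0) {m₀ m₁ m₂ : ℤ} (hdx : (d : 𝓞 K) * x = lin hθ m₀ m₁ m₂) {N : ℤ}
    (hN : MonicCubic.normForm a b c m₀ m₁ m₂ = (((d : ℤ) ^ 3 * N : ℤ) : ℚ)) (hp : N.natAbs.Prime) :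
    Prime x := by
  apply prime_of_natAbs_norm_prime
  rw [natAbs_norm_eq_of_norm_eq (norm_of_dmul hirr hθ h3 hd hdx hN)]
  exact hp

/-- **Prime of degree `k = 2, 3`**: `|N(x)| = p^k` and no residue map `𝓞 K → ℤ/p` kills `x`.
[cite: Marcus2018, Ch. 3, Thm. 22] -/
theorem prime_of_dmul_pow [NumberField K] (hirr : Irreducible (MonicCubic.polyQ a b c))
    (hθ : aeval θ (MonicCubic.poly a b c) = 0) (h3 : finrank ℚ K = 3) {x : 𝓞 K} {d : ℕ}
    (hd : d ≠ 0) {m₀ m₁ m₂ : ℤ} (hdx : (d : 𝓞 K) * x = lin hθ m₀ m₁ m₂) {N : ℤ}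
    (hN : MonicCubic.normForm a b c m₀ m₁ m₂ = (((d : ℤ) ^ 3 * N : ℤ) : ℚ)) {p k : ℕ}
    (hp : p.Prime) (hk : k = 2 ∨ k = 3) (hNp : N.natAbs = p ^ k)
    (hψ : ∀ ψ : 𝓞 K →+* ZMod p, ψ x ≠ 0) : Prime x :=
  prime_of_natAbs_norm_eq_prime_pow hp hk
    (by rw [natAbs_norm_eq_of_norm_eq (norm_of_dmul hirr hθ h3 hd hdx hN), hNp]) hψ

/-- **Norm of `n₀ + n₁ω₁ + n₂ω₂`.** [folklore] -/
theorem linB_norm [NumberField K] (hirr : Irreducible (MonicCubic.polyQ a b c))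
    (hθ : aeval θ (MonicCubic.poly a b c) = 0) (h3 : finrank ℚ K = 3) {ω₁ ω₂ : 𝓞 K} {d : ℕ}
    {a₀ a₁ a₂ b₀ b₁ b₂ : ℤ}
    (h₁ : (d : 𝓞 K) * ω₁ = lin hθ a₀ a₁ a₂) (h₂ : (d : 𝓞 K) * ω₂ = lin hθ b₀ b₁ b₂) (hd : d ≠ 0)
    (n₀ n₁ n₂ : ℤ) {N : ℤ}
    (hN : MonicCubic.normForm a b c (d * n₀ + n₁ * a₀ + n₂ * b₀ : ℤ) (n₁ * a₁ + n₂ * b₁ : ℤ)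
      (n₁ * a₂ + n₂ * b₂ : ℤ) = (((d : ℤ) ^ 3 * N : ℤ) : ℚ)) :
    Algebra.norm ℚ ((linB ω₁ ω₂ n₀ n₁ n₂ : 𝓞 K) : K) = (N : ℚ) :=
  norm_of_dmul hirr hθ h3 hd (dmul_linB hθ h₁ h₂ n₀ n₁ n₂) hN

/-- **`n₀ + n₁ω₁ + n₂ω₂` is a prime of degree one** (`|N| = p`). [cite: Marcus2018, Ch. 3, Thm. 22] -/
theorem linB_prime [NumberField K] (hirr : Irreducible (MonicCubic.polyQ a b c))
    (hθ : aeval θ (MonicCubic.poly a b c) = 0) (h3 : finrank ℚ K = 3) {ω₁ ω₂ : 𝓞 K} {d : ℕ}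
    {a₀ a₁ a₂ b₀ b₁ b₂ : ℤ}
    (h₁ : (d : 𝓞 K) * ω₁ = lin hθ a₀ a₁ a₂) (h₂ : (d : 𝓞 K) * ω₂ = lin hθ b₀ b₁ b₂) (hd : d ≠ 0)
    (n₀ n₁ n₂ : ℤ) {N : ℤ}
    (hN : MonicCubic.normForm a b c (d * n₀ + n₁ * a₀ + n₂ * b₀ : ℤ) (n₁ * a₁ + n₂ * b₁ : ℤ)
      (n₁ * a₂ + n₂ * b₂ : ℤ) = (((d : ℤ) ^ 3 * N : ℤ) : ℚ)) (hp : N.natAbs.Prime) :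
    Prime (linB ω₁ ω₂ n₀ n₁ n₂) :=
  prime_of_dmul hirr hθ h3 hd (dmul_linB hθ h₁ h₂ n₀ n₁ n₂) hN hp

/-- **`n₀ + n₁ω₁ + n₂ω₂` is a prime of degree `2` or `3`** (`|N| = p^k` plus the residual
certificate). [cite: Marcus2018, Ch. 3, Thm. 22] -/
theorem linB_prime_pow [NumberField K] (hirr : Irreducible (MonicCubic.polyQ a b c))
    (hθ : aeval θ (MonicCubic.poly a b c) = 0) (h3 : finrank ℚ K = 3) {ω₁ ω₂ : 𝓞 K} {d : ℕ}
    {a₀ a₁ a₂ b₀ b₁ b₂ : ℤ}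
    (h₁ : (d : 𝓞 K) * ω₁ = lin hθ a₀ a₁ a₂) (h₂ : (d : 𝓞 K) * ω₂ = lin hθ b₀ b₁ b₂) (hd : d ≠ 0)
    (n₀ n₁ n₂ : ℤ) {N : ℤ}
    (hN : MonicCubic.normForm a b c (d * n₀ + n₁ * a₀ + n₂ * b₀ : ℤ) (n₁ * a₁ + n₂ * b₁ : ℤ)
      (n₁ * a₂ + n₂ * b₂ : ℤ) = (((d : ℤ) ^ 3 * N : ℤ) : ℚ)) {p k : ℕ} (hp : p.Prime)
    (hk : k = 2 ∨ k = 3) (hNp : N.natAbs = p ^ k)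
    (hψ : ∀ ψ : 𝓞 K →+* ZMod p, ψ (linB ω₁ ω₂ n₀ n₁ n₂) ≠ 0) :
    Prime (linB ω₁ ω₂ n₀ n₁ n₂) :=
  prime_of_dmul_pow hirr hθ h3 hd (dmul_linB hθ h₁ h₂ n₀ n₁ n₂) hN hp hk hNp hψ

/-! ## Signs at real places through `d·x ∈ ℤ[α]` -/

/-- **Positive at `ρ`** from `d·x = lin hα m` and the interval certificate for `m`. [folklore] -/
theorem pos_of_dmul [NumberField K] (hθ : aeval θ (MonicCubic.poly a b c) = 0) {x : 𝓞 K} {d : ℕ} (hd : 0 < d)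
    {m₀ m₁ m₂ : ℤ} (hdx : (d : 𝓞 K) * x = lin hθ m₀ m₁ m₂) (ρ : K →+* ℝ) {lo hi : ℚ}
    (h0 : 0 ≤ lo) (hlo : ((lo : ℚ) : ℝ) < ρ θ) (hhi : ρ θ < ((hi : ℚ) : ℝ))
    (hc : 0 < (m₀ : ℚ) + min (m₁ * lo) (m₁ * hi) + min (m₂ * lo ^ 2) (m₂ * hi ^ 2)) :
    0 < ρ ((x : 𝓞 K) : K) := by
  have h := lin_pos hθ ρ h0 hlo hhi m₀ m₁ m₂ hc
  rw [← hdx] at h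
  simp only [map_mul, map_natCast] at h
  have hd' : (0 : ℝ) < d := Nat.cast_pos.mpr hd
  nlinarith [h, hd']

/-- **Negative at `ρ`** from `d·x = lin hα m` and the interval certificate for `m`. [folklore] -/
theorem neg_of_dmul [NumberField K] (hθ : aeval θ (MonicCubic.poly a b c) = 0) {x : 𝓞 K} {d : ℕ} (hd : 0 < d)
    {m₀ m₁ m₂ : ℤ} (hdx : (d : 𝓞 K) * x = lin hθ m₀ m₁ m₂) (ρ : K →+* ℝ) {lo hi : ℚ}
    (h0 : 0 ≤ lo) (hlo : ((lo : ℚ) : ℝ) < ρ θ) (hhi : ρ θ < ((hi : ℚ) : ℝ))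
    (hc : (m₀ : ℚ) + max (m₁ * lo) (m₁ * hi) + max (m₂ * lo ^ 2) (m₂ * hi ^ 2) < 0) :
    ρ ((x : 𝓞 K) : K) < 0 := by
  have h := lin_neg hθ ρ h0 hlo hhi m₀ m₁ m₂ hc
  rw [← hdx] at h
  simp only [map_mul, map_natCast] at h
  have hd' : (0 : ℝ) < d := Nat.cast_pos.mpr hd
  nlinarith [h, hd']

/-- **Ordering two real places on `x`** from `d·x = lin hα m`. [folklore] -/
theorem lt_of_dmul [NumberField K] (hθ : aeval θ (MonicCubic.poly a b c) = 0) {x : 𝓞 K} {d : ℕ} (hd : 0 < d)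
    {m₀ m₁ m₂ : ℤ} (hdx : (d : 𝓞 K) * x = lin hθ m₀ m₁ m₂) (ρ ρ' : K →+* ℝ)
    {lo hi lo' hi' : ℚ} (h0 : 0 ≤ lo) (hlo : ((lo : ℚ) : ℝ) < ρ θ) (hhi : ρ θ < ((hi : ℚ) : ℝ))
    (h0' : 0 ≤ lo') (hlo' : ((lo' : ℚ) : ℝ) < ρ' θ) (hhi' : ρ' θ < ((hi' : ℚ) : ℝ))
    (hc : (m₀ : ℚ) + max (m₁ * lo) (m₁ * hi) + max (m₂ * lo ^ 2) (m₂ * hi ^ 2) <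
      (m₀ : ℚ) + min (m₁ * lo') (m₁ * hi') + min (m₂ * lo' ^ 2) (m₂ * hi' ^ 2)) :
    ρ ((x : 𝓞 K) : K) < ρ' ((x : 𝓞 K) : K) := by
  have h := lin_lt_lin hθ ρ ρ' h0 hlo hhi h0' hlo' hhi' m₀ m₁ m₂ hc
  rw [← hdx] at h
  simp only [map_mul, map_natCast] at h
  have hd' : (0 : ℝ) < d := Nat.cast_pos.mpr hd
  nlinarith [h, hd']

/-- `linB_pos`: **`n₀ + n₁ω₁ + n₂ω₂ > 0` at `ρ`** from the interval certificate for `d·x`. [folklore] -/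
theorem linB_pos [NumberField K] (hθ : aeval θ (MonicCubic.poly a b c) = 0) {ω₁ ω₂ : 𝓞 K} {d : ℕ}
    {a₀ a₁ a₂ b₀ b₁ b₂ : ℤ}
    (h₁ : (d : 𝓞 K) * ω₁ = lin hθ a₀ a₁ a₂) (h₂ : (d : 𝓞 K) * ω₂ = lin hθ b₀ b₁ b₂) (hd : 0 < d)
    (ρ : K →+* ℝ) {lo hi : ℚ} (h0 : 0 ≤ lo) (hlo : ((lo : ℚ) : ℝ) < ρ θ)
    (hhi : ρ θ < ((hi : ℚ) : ℝ)) (n₀ n₁ n₂ : ℤ)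
    (hc : 0 < ((d * n₀ + n₁ * a₀ + n₂ * b₀ : ℤ) : ℚ) +
      min (((n₁ * a₁ + n₂ * b₁ : ℤ) : ℚ) * lo) (((n₁ * a₁ + n₂ * b₁ : ℤ) : ℚ) * hi) +
      min (((n₁ * a₂ + n₂ * b₂ : ℤ) : ℚ) * lo ^ 2) (((n₁ * a₂ + n₂ * b₂ : ℤ) : ℚ) * hi ^ 2)) :
    0 < ρ ((linB ω₁ ω₂ n₀ n₁ n₂ : 𝓞 K) : K) :=
  pos_of_dmul hθ hd (dmul_linB hθ h₁ h₂ n₀ n₁ n₂) ρ h0 hlo hhi hc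

/-- `linB_neg`: **`n₀ + n₁ω₁ + n₂ω₂ < 0` at `ρ`** from the interval certificate for `d·x`. [folklore] -/
theorem linB_neg [NumberField K] (hθ : aeval θ (MonicCubic.poly a b c) = 0) {ω₁ ω₂ : 𝓞 K} {d : ℕ}
    {a₀ a₁ a₂ b₀ b₁ b₂ : ℤ}
    (h₁ : (d : 𝓞 K) * ω₁ = lin hθ a₀ a₁ a₂) (h₂ : (d : 𝓞 K) * ω₂ = lin hθ b₀ b₁ b₂) (hd : 0 < d)
    (ρ : K →+* ℝ) {lo hi : ℚ} (h0 : 0 ≤ lo) (hlo : ((lo : ℚ) : ℝ) < ρ θ)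
    (hhi : ρ θ < ((hi : ℚ) : ℝ)) (n₀ n₁ n₂ : ℤ)
    (hc : ((d * n₀ + n₁ * a₀ + n₂ * b₀ : ℤ) : ℚ) +
      max (((n₁ * a₁ + n₂ * b₁ : ℤ) : ℚ) * lo) (((n₁ * a₁ + n₂ * b₁ : ℤ) : ℚ) * hi) +
      max (((n₁ * a₂ + n₂ * b₂ : ℤ) : ℚ) * lo ^ 2) (((n₁ * a₂ + n₂ * b₂ : ℤ) : ℚ) * hi ^ 2) < 0) :
    ρ ((linB ω₁ ω₂ n₀ n₁ n₂ : 𝓞 K) : K) < 0 :=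
  neg_of_dmul hθ hd (dmul_linB hθ h₁ h₂ n₀ n₁ n₂) ρ h0 hlo hhi hc

/-- `linB_lt_linB`: **`ρ(x) < ρ'(x)`** for `x = n₀ + n₁ω₁ + n₂ω₂` from the two intervals. [folklore] -/
theorem linB_lt_linB [NumberField K] (hθ : aeval θ (MonicCubic.poly a b c) = 0) {ω₁ ω₂ : 𝓞 K} {d : ℕ}
    {a₀ a₁ a₂ b₀ b₁ b₂ : ℤ}
    (h₁ : (d : 𝓞 K) * ω₁ = lin hθ a₀ a₁ a₂) (h₂ : (d : 𝓞 K) * ω₂ = lin hθ b₀ b₁ b₂) (hd : 0 < d)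
    (ρ ρ' : K →+* ℝ) {lo hi lo' hi' : ℚ} (h0 : 0 ≤ lo) (hlo : ((lo : ℚ) : ℝ) < ρ θ)
    (hhi : ρ θ < ((hi : ℚ) : ℝ)) (h0' : 0 ≤ lo') (hlo' : ((lo' : ℚ) : ℝ) < ρ' θ)
    (hhi' : ρ' θ < ((hi' : ℚ) : ℝ)) (n₀ n₁ n₂ : ℤ)
    (hc : ((d * n₀ + n₁ * a₀ + n₂ * b₀ : ℤ) : ℚ) +
      max (((n₁ * a₁ + n₂ * b₁ : ℤ) : ℚ) * lo) (((n₁ * a₁ + n₂ * b₁ : ℤ) : ℚ) * hi) +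
      max (((n₁ * a₂ + n₂ * b₂ : ℤ) : ℚ) * lo ^ 2) (((n₁ * a₂ + n₂ * b₂ : ℤ) : ℚ) * hi ^ 2) <
      ((d * n₀ + n₁ * a₀ + n₂ * b₀ : ℤ) : ℚ) +
      min (((n₁ * a₁ + n₂ * b₁ : ℤ) : ℚ) * lo') (((n₁ * a₁ + n₂ * b₁ : ℤ) : ℚ) * hi') +
      min (((n₁ * a₂ + n₂ * b₂ : ℤ) : ℚ) * lo' ^ 2) (((n₁ * a₂ + n₂ * b₂ : ℤ) : ℚ) * hi' ^ 2)) :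
    ρ ((linB ω₁ ω₂ n₀ n₁ n₂ : 𝓞 K) : K) < ρ' ((linB ω₁ ω₂ n₀ n₁ n₂ : 𝓞 K) : K) :=
  lt_of_dmul hθ hd (dmul_linB hθ h₁ h₂ n₀ n₁ n₂) ρ ρ' h0 hlo hhi h0' hlo' hhi' hc

/-! ## Residue maps: values on `linB`, and the enumeration by pairs at the index primes -/

/-- The value of a residue map on `n₀ + n₁ω₁ + n₂ω₂` from the pair `(ψ ω₁, ψ ω₂)`. [folklore] -/
theorem psi_linB {p : ℕ} (ψ : 𝓞 K →+* ZMod p) {ω₁ ω₂ : 𝓞 K} {u₁ u₂ : ZMod p}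
    (e₁ : ψ ω₁ = u₁) (e₂ : ψ ω₂ = u₂) (n₀ n₁ n₂ : ℤ) :
    ψ (linB ω₁ ω₂ n₀ n₁ n₂) = (n₀ : ZMod p) + (n₁ : ZMod p) * u₁ + (n₂ : ZMod p) * u₂ := by
  simp only [linB, map_add, map_mul, map_intCast, e₁, e₂]

/-- **`ψ(ω)` from the root `t = ψ(α)` at a prime not dividing `d`**: `d·ω = a₀ + a₁α + a₂α²` and
`d·d' = 1` in `ℤ/p` give `ψ(ω) = d'·(a₀ + a₁t + a₂t²)`. [cite: Marcus2018, Ch. 3, Thm. 27] -/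
theorem psi_eq_of_dmul {p : ℕ} (ψ : 𝓞 K →+* ZMod p) (hθ : aeval θ (MonicCubic.poly a b c) = 0)
    {ω : 𝓞 K} {d : ℕ} {a₀ a₁ a₂ : ℤ} (h : (d : 𝓞 K) * ω = lin hθ a₀ a₁ a₂) {t : ZMod p}
    (ht : ψ (MonicCubic.thetaInt hθ) = t) {d' : ZMod p} (hd' : (d : ZMod p) * d' = 1) :
    ψ ω = d' * ((a₀ : ZMod p) + (a₁ : ZMod p) * t + (a₂ : ZMod p) * t ^ 2) := by
  have h' := congrArg ψ h
  simp only [map_mul, map_natCast, lin, map_add, map_pow, map_intCast, ht] at h'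
  calc ψ ω = (d' * (d : ZMod p)) * ψ ω := by rw [mul_comm d', hd', one_mul]
    _ = d' * ((d : ZMod p) * ψ ω) := by ring
    _ = d' * ((a₀ : ZMod p) + (a₁ : ZMod p) * t + (a₂ : ZMod p) * t ^ 2) := by rw [h']

/-- **`ψ(n₀ + n₁ω₁ + n₂ω₂)` from the root `t = ψ(α)`** (`p ∤ d`). [cite: Marcus2018, Ch. 3, Thm. 27] -/
theorem psi_linB_of_root {p : ℕ} (ψ : 𝓞 K →+* ZMod p)
    (hθ : aeval θ (MonicCubic.poly a b c) = 0) {ω₁ ω₂ : 𝓞 K} {d : ℕ} {a₀ a₁ a₂ b₀ b₁ b₂ : ℤ}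
    (h₁ : (d : 𝓞 K) * ω₁ = lin hθ a₀ a₁ a₂) (h₂ : (d : 𝓞 K) * ω₂ = lin hθ b₀ b₁ b₂) {t : ZMod p}
    (ht : ψ (MonicCubic.thetaInt hθ) = t) {d' : ZMod p} (hd' : (d : ZMod p) * d' = 1)
    (n₀ n₁ n₂ : ℤ) :
    ψ (linB ω₁ ω₂ n₀ n₁ n₂) = (n₀ : ZMod p) +
      (n₁ : ZMod p) * (d' * ((a₀ : ZMod p) + (a₁ : ZMod p) * t + (a₂ : ZMod p) * t ^ 2)) +
      (n₂ : ZMod p) * (d' * ((b₀ : ZMod p) + (b₁ : ZMod p) * t + (b₂ : ZMod p) * t ^ 2)) :=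
  psi_linB ψ (psi_eq_of_dmul ψ hθ h₁ ht hd') (psi_eq_of_dmul ψ hθ h₂ ht hd') n₀ n₁ n₂

/-- A product relation `x·y = s₀ + s₁ω₁ + s₂ω₂` in `𝓞 K` read through a residue map. [folklore] -/
theorem psi_rel {p : ℕ} (ψ : 𝓞 K →+* ZMod p) {ω₁ ω₂ x y : 𝓞 K} {s₀ s₁ s₂ : ℤ}
    (h : x * y = linB ω₁ ω₂ s₀ s₁ s₂) :
    ψ x * ψ y = (s₀ : ZMod p) + (s₁ : ZMod p) * ψ ω₁ + (s₂ : ZMod p) * ψ ω₂ := by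
  rw [← map_mul, h, psi_linB ψ rfl rfl]

/-- **The certificate condition at an index prime, by pairs**: every residue map `ψ : 𝓞 K → ℤ/p`
has `(ψ ω₁, ψ ω₂)` among the solutions `(u₁, u₂) ∈ (ℤ/p)²` of the multiplication table of
`(ω₁, ω₂)`; answering each solution with a prime element killed by `ψ` certifies `p`.
[cite: Marcus2018, Ch. 3, Thm. 27] -/
theorem cert_of_pairs {p : ℕ} (ψ : 𝓞 K →+* ZMod p) {ω₁ ω₂ : 𝓞 K}
    {s₀ s₁ s₂ t₀ t₁ t₂ r₀ r₁ r₂ : ℤ}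
    (h11 : ω₁ * ω₁ = linB ω₁ ω₂ s₀ s₁ s₂) (h12 : ω₁ * ω₂ = linB ω₁ ω₂ t₀ t₁ t₂)
    (h22 : ω₂ * ω₂ = linB ω₁ ω₂ r₀ r₁ r₂)
    (H : ∀ u₁ u₂ : ZMod p,
      u₁ * u₁ = (s₀ : ZMod p) + (s₁ : ZMod p) * u₁ + (s₂ : ZMod p) * u₂ →
      u₁ * u₂ = (t₀ : ZMod p) + (t₁ : ZMod p) * u₁ + (t₂ : ZMod p) * u₂ →
      u₂ * u₂ = (r₀ : ZMod p) + (r₁ : ZMod p) * u₁ + (r₂ : ZMod p) * u₂ →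
      ψ ω₁ = u₁ → ψ ω₂ = u₂ → ∃ e : 𝓞 K, ψ e = 0 ∧ Prime e) :
    ∃ e : 𝓞 K, ψ e = 0 ∧ Prime e :=
  H _ _ (psi_rel ψ h11) (psi_rel ψ h12) (psi_rel ψ h22) rfl rfl

/-- **Residual non-vanishing by pairs**: `ψ(n₀ + n₁ω₁ + n₂ω₂) ≠ 0` for every residue map at `p`,
from the finite check over the solutions of the multiplication table. [folklore] -/
theorem psi_linB_ne_zero_of_pairs {p : ℕ} (ψ : 𝓞 K →+* ZMod p) {ω₁ ω₂ : 𝓞 K}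
    {s₀ s₁ s₂ t₀ t₁ t₂ r₀ r₁ r₂ : ℤ}
    (h11 : ω₁ * ω₁ = linB ω₁ ω₂ s₀ s₁ s₂) (h12 : ω₁ * ω₂ = linB ω₁ ω₂ t₀ t₁ t₂)
    (h22 : ω₂ * ω₂ = linB ω₁ ω₂ r₀ r₁ r₂) (n₀ n₁ n₂ : ℤ)
    (hdec : ∀ u₁ u₂ : ZMod p,
      u₁ * u₁ = (s₀ : ZMod p) + (s₁ : ZMod p) * u₁ + (s₂ : ZMod p) * u₂ →
      u₁ * u₂ = (t₀ : ZMod p) + (t₁ : ZMod p) * u₁ + (t₂ : ZMod p) * u₂ →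
      u₂ * u₂ = (r₀ : ZMod p) + (r₁ : ZMod p) * u₁ + (r₂ : ZMod p) * u₂ →
      (n₀ : ZMod p) + (n₁ : ZMod p) * u₁ + (n₂ : ZMod p) * u₂ ≠ 0) :
    ψ (linB ω₁ ω₂ n₀ n₁ n₂) ≠ 0 := by
  rw [psi_linB ψ rfl rfl]
  exact hdec _ _ (psi_rel ψ h11) (psi_rel ψ h12) (psi_rel ψ h22)

/-- **Residual non-vanishing by roots** (`p ∤ d`): `ψ(n₀ + n₁ω₁ + n₂ω₂) ≠ 0` for every residue map
at `p`, from the finite check over the roots `t` of the cubic mod `p`. [folklore] -/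
theorem psi_linB_ne_zero_of_roots [NumberField K] {p : ℕ} (ψ : 𝓞 K →+* ZMod p)
    (hθ : aeval θ (MonicCubic.poly a b c) = 0) {ω₁ ω₂ : 𝓞 K} {d : ℕ} {a₀ a₁ a₂ b₀ b₁ b₂ : ℤ}
    (h₁ : (d : 𝓞 K) * ω₁ = lin hθ a₀ a₁ a₂) (h₂ : (d : 𝓞 K) * ω₂ = lin hθ b₀ b₁ b₂)
    {d' : ZMod p} (hd' : (d : ZMod p) * d' = 1) (n₀ n₁ n₂ : ℤ)
    (hdec : ∀ t : ZMod p, t ^ 3 + (a : ZMod p) * t ^ 2 + (b : ZMod p) * t + (c : ZMod p) = 0 →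
      (n₀ : ZMod p) +
        (n₁ : ZMod p) * (d' * ((a₀ : ZMod p) + (a₁ : ZMod p) * t + (a₂ : ZMod p) * t ^ 2)) +
        (n₂ : ZMod p) * (d' * ((b₀ : ZMod p) + (b₁ : ZMod p) * t + (b₂ : ZMod p) * t ^ 2)) ≠ 0) :
    ψ (linB ω₁ ω₂ n₀ n₁ n₂) ≠ 0 := by
  rw [psi_linB_of_root ψ hθ h₁ h₂ rfl hd' n₀ n₁ n₂]
  exact hdec _ (map_thetaInt_root hθ ψ)

end Summit.BirchSwinnertonDyer.BirchSwinnertonDyer.Rank2Observatory.TwoDescCubic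

end
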